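import Summits.QuantumFields.GaugeBoot.TiltedBoxLimitGeometry
import Summits.QuantumFields.GaugeBoot.TiltedLatticeHaarShift
import Summits.QuantumFields.GaugeBoot.ClassBHaarShift
import HarnessLib

/-!
# Infinite-volume limit points of the 45°-tilted boxes, part 6: the one-link Haar-shift (Gibbs) identity

HONEST FRAMING (cell `pub-gaugeboot`, page 1 of every file): the venture produces certified bounds
on lattice expectations at stated coupling, gauge group, dimension and torus size; NOT a mass gap,
NOT a continuum limit, NOT a string tension; NOT Yang–Mills-summit-bearing (barriers
`FixedCouplingUltralocality`, `PerturbativeInvisibility`). A structural fact about a class of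
infinite-volume Wilson states; nothing else is claimed.

**`isHaarShiftState_of_mem_tiltedBoxLimitPoints`.** Every tilted limit point
`μ ∈ tiltedBoxLimitPoints d i j ρ β` (`TiltedBoxLimitPoints.lean`; compact Hausdorff second countable
`G`, continuous `ρ`, every real `β`) is a one-link Gibbs state of the Wilson action in the sense of
`ClassB.lean` (`IsHaarShiftState ρ β μ`):
`∫ f(U[e ↦ g U_e]) dμ = ∫ f(U) exp(-β (S_e(U[e ↦ g⁻¹ U_e]) - S_e(U))) dμ` for every link `e`,
`g ∈ G` and continuous cylinder `f`, `S_e = wilsonBoundaryAction ρ {e}` — the axiom from which the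
loop (Schwinger–Dyson) equations of an infinite-volume state are read off.

Proof. On each box the Wilson measure obeys the identity with the FULL action
(`integral_comp_update_mul_gibbs`, `TiltedLatticeHaarShift.lean`). A non-zero vector of `Γ` has a
coordinate of size `≥ min(M_u, M_v, L)` (`eq_zero_of_mem_tiltedLattice_of_abs_lt`), so along the
family the quotient map is eventually injective on any finite set of sites (`eventually_injOn_mk`);
then (i) updating the box link below `e` and lifting is updating the lift at `e`, as seen by cylinder
observables near `e` (`apply_update_tiltedLift`), and (ii) the change of the full box action equals
the change of `S_e` of the lift (`wilsonAction_update_sub_eq`: the box plaquettes containing the link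
are the classes of the plaquettes of `ℤ^d` containing `e`; no other term changes). Both sides of the
identity are limits of eventually equal box expectations.

References: H.-O. Georgii, Gibbs Measures and Phase Transitions (2011) Def. 2.9; E. Seiler, LNP 159
(1982) Ch. 2; S. Cao, M. Park, S. Sheffield, Comm. AMS 5 (2025)
Thm. 5.7 (`U(N)`) / Thm. 6.104 (`SU(N)`) (arXiv:2307.06790 numbering; informally Thm. 1.14).
-/

noncomputable section

open MeasureTheory Filter Topology Finset
open Literature.Probability.LatticeModels (Site)
open Literature.MathematicalPhysics.QuantumLattice

namespace Summit.QuantumFields.GaugeBoot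

namespace TiltedRP

/-! ## Short lattice vectors vanish; injectivity of the quotient map on bounded sets -/

section Injectivity

variable {d : ℕ} {i j : Fin d} {Mu Mv L : ℕ}

/-- **A vector of `Γ(M_u, M_v, L)` all of whose coordinates are smaller than `M_u`, `M_v` and `L`
in absolute value is zero.** -/
theorem eq_zero_of_mem_tiltedLattice_of_abs_lt {x : Site d} (hx : x ∈ tiltedLattice d i j Mu Mv L)
    (hMu : ∀ k, |x k| < Mu) (hMv : ∀ k, |x k| < Mv) (hL : ∀ k, |x k| < L) : x = 0 := by
  rw [mem_tiltedLattice_iff] at hx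
  obtain ⟨h1, h2, h3⟩ := hx
  have hs : x i + x j = 0 := Int.eq_zero_of_abs_lt_dvd h1 (by
    have := abs_add_le (x i) (x j)
    have hi := hMu i; have hj := hMu j
    push_cast; linarith)
  have hd : x i - x j = 0 := Int.eq_zero_of_abs_lt_dvd h2 (by
    have := abs_sub (x i) (x j)
    have hi := hMv i; have hj := hMv j
    push_cast; linarith)
  funext k
  by_cases hki : k = i
  · subst hki; simp only [Pi.zero_apply]; omega
  by_cases hkj : k = j
  · subst hkj; simp only [Pi.zero_apply]; omega
  exact Int.eq_zero_of_abs_lt_dvd (h3 k hki hkj) (hL k)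

/-- **The quotient map `ℤ^d → ℤ^d/Γ` is injective on a set of sites of coordinate-wise diameter
`≤ R` as soon as `R < M_u, M_v, L`.** -/
theorem injOn_mk_of_lt {B : Finset (Site d)} {R : ℕ} (hB : ∀ x ∈ B, ∀ y ∈ B, ∀ k, |x k - y k| ≤ R)
    (hMu : R < Mu) (hMv : R < Mv) (hL : R < L) :
    Set.InjOn (fun x : Site d => (x : TiltedSite d i j Mu Mv L)) ↑B := by
  intro x hx y hy hxy
  have hmem : x - y ∈ tiltedLattice d i j Mu Mv L := (QuotientAddGroup.eq_iff_sub_mem).1 hxy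
  have h0 := eq_zero_of_mem_tiltedLattice_of_abs_lt hmem
    (fun k => by have := hB x hx y hy k; simp only [Pi.sub_apply]; omega)
    (fun k => by have := hB x hx y hy k; simp only [Pi.sub_apply]; omega)
    (fun k => by have := hB x hx y hy k; simp only [Pi.sub_apply]; omega)
  exact sub_eq_zero.1 h0

/-- Every finite set of sites has a coordinate-wise diameter. -/
theorem exists_diam (B : Finset (Site d)) : ∃ R : ℕ, ∀ x ∈ B, ∀ y ∈ B, ∀ k, |x k - y k| ≤ R := by
  refine ⟨B.sup fun x => B.sup fun y => univ.sup fun k => (x k - y k).natAbs, ?_⟩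
  intro x hx y hy k
  have h : (x k - y k).natAbs ≤ B.sup fun x => B.sup fun y => univ.sup fun k => (x k - y k).natAbs :=
    le_sup_of_le hx (le_sup_of_le hy (le_sup (f := fun k => (x k - y k).natAbs) (mem_univ k)))
  rw [← Int.natCast_natAbs]
  exact_mod_cast h

/-- **Along a tilted family the quotient maps are eventually injective on any finite set of sites.** -/
theorem eventually_injOn_mk {M Q : ℕ → ℕ} (hM : Tendsto M atTop atTop) (hQ : Tendsto Q atTop atTop)
    (B : Finset (Site d)) :
    ∀ᶠ k in atTop, Set.InjOn
      (fun x : Site d => (x : TiltedSite d i j (M k + 2) (M k + 2) (2 * (Q k + 2)))) ↑B := by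
  obtain ⟨R, hR⟩ := exists_diam B
  filter_upwards [hM.eventually_ge_atTop R, hQ.eventually_ge_atTop R] with k hk hk'
  exact injOn_mk_of_lt hR (by omega) (by omega) (by omega)

/-- Injectivity on edges from injectivity on their base points. -/
theorem injOn_tiltedEdge {T : Finset (ZdEdge d)}
    (h : Set.InjOn (fun x : Site d => (x : TiltedSite d i j Mu Mv L)) ↑(T.image Prod.fst)) :
    Set.InjOn (tiltedEdge d i j Mu Mv L) ↑T := by
  intro e₁ h₁ e₂ h₂ he
  simp only [tiltedEdge, Prod.mk.injEq] at he
  refine Prod.ext (h ?_ ?_ he.1) he.2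
  · exact mem_coe.2 (mem_image_of_mem _ h₁)
  · exact mem_coe.2 (mem_image_of_mem _ h₂)

end Injectivity

/-! ## Plaquettes of the box versus plaquettes of `ℤ^d` -/

section Plaquettes

variable {d : ℕ} {i j : Fin d} {Mu Mv L N : ℕ} {G : Type*} [Group G]
variable (ρ : G →* Matrix (Fin N) (Fin N) ℂ)

/-- Box holonomies at a class are `ℤ^d` holonomies of the lift. -/
theorem holonomy_mk (V : Config (TiltedSite d i j Mu Mv L) d G) (x : Site d) (k l : Fin d) :
    holonomy (tiltedUnit d i j Mu Mv L) V (x : TiltedSite d i j Mu Mv L) k l =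
      plaquetteHolonomyZd (tiltedLift d i j Mu Mv L V) x k l := by
  simp only [holonomy, plaquetteHolonomyZd, tiltedLift_apply, mk_add_single]

omit [Group G] in
/-- A box plaquette one of whose four links is the class of the edge `e` is the class of a
plaquette of `ℤ^d` containing `e`. -/
theorem exists_mk_eq_of_tiltedEdge_eq (e : ZdEdge d) (q : Plaq (TiltedSite d i j Mu Mv L) d)
    (hq : tiltedEdge d i j Mu Mv L e = (q.1, q.2.1.1) ∨
      tiltedEdge d i j Mu Mv L e = (q.1 + tiltedUnit d i j Mu Mv L q.2.1.1, q.2.1.2) ∨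
      tiltedEdge d i j Mu Mv L e = (q.1 + tiltedUnit d i j Mu Mv L q.2.1.2, q.2.1.1) ∨
      tiltedEdge d i j Mu Mv L e = (q.1, q.2.1.2)) :
    ∃ p ∈ plaquettesTouching ({e} : Finset (ZdEdge d)),
      (((p.1 : TiltedSite d i j Mu Mv L), p.2) : Plaq (TiltedSite d i j Mu Mv L) d) = q := by
  obtain ⟨x, k⟩ := e
  obtain ⟨y, ij⟩ := q
  have he : ((x, k) : ZdEdge d) ∈ ({(x, k)} : Finset (ZdEdge d)) := mem_singleton_self _
  simp only [tiltedEdge, Prod.mk.injEq] at hq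
  rcases hq with ⟨h1, h2⟩ | ⟨h1, h2⟩ | ⟨h1, h2⟩ | ⟨h1, h2⟩
  · refine ⟨(x, ij), mem_plaquettesTouching_iff.2 ⟨(x, k), mem_inter.2 ⟨?_, he⟩⟩, ?_⟩
    · simp [plaquetteEdges, h2]
    · simp [h1]
  · refine ⟨(x - Pi.single ij.1.1 1, ij),
      mem_plaquettesTouching_iff.2 ⟨(x, k), mem_inter.2 ⟨?_, he⟩⟩, ?_⟩
    · simp [plaquetteEdges, h2]
    · refine Prod.ext ?_ rfl
      show ((x - Pi.single ij.1.1 1 : Site d) : TiltedSite d i j Mu Mv L) = y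
      rw [mk_sub_single, h1, add_sub_cancel_right]
  · refine ⟨(x - Pi.single ij.1.2 1, ij),
      mem_plaquettesTouching_iff.2 ⟨(x, k), mem_inter.2 ⟨?_, he⟩⟩, ?_⟩
    · simp [plaquetteEdges, h2]
    · refine Prod.ext ?_ rfl
      show ((x - Pi.single ij.1.2 1 : Site d) : TiltedSite d i j Mu Mv L) = y
      rw [mk_sub_single, h1, add_sub_cancel_right]
  · refine ⟨(x, ij), mem_plaquettesTouching_iff.2 ⟨(x, k), mem_inter.2 ⟨?_, he⟩⟩, ?_⟩
    · simp [plaquetteEdges, h2]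
    · simp [h1]

omit [Group G] in
/-- The quotient map is injective on the plaquettes touching `Λ` once it is injective on the base
points of their edges. -/
theorem injOn_mkPlaquette {Λ : Finset (ZdEdge d)}
    (h : Set.InjOn (fun x : Site d => (x : TiltedSite d i j Mu Mv L))
      ↑(((plaquettesTouching Λ).biUnion plaquetteEdges).image Prod.fst)) :
    Set.InjOn (fun p : ZdPlaquette d =>
      ((((p.1 : TiltedSite d i j Mu Mv L)), p.2) : Plaq (TiltedSite d i j Mu Mv L) d))
      ↑(plaquettesTouching Λ) := by
  intro p₁ h₁ p₂ h₂ hp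
  simp only [Prod.mk.injEq] at hp
  refine Prod.ext (h ?_ ?_ hp.1) hp.2
  · exact mem_coe.2 (mem_image.2 ⟨(p₁.1, p₁.2.1.1), mem_biUnion.2 ⟨p₁, h₁, by simp [plaquetteEdges]⟩, rfl⟩)
  · exact mem_coe.2 (mem_image.2 ⟨(p₂.1, p₂.2.1.1), mem_biUnion.2 ⟨p₂, h₂, by simp [plaquetteEdges]⟩, rfl⟩)

/-- **Near part**: the box plaquette terms over the classes of the plaquettes touching `Λ` sum to the
boundary Wilson action of the lift. -/
theorem sum_image_mk_plaquetteTerm [DecidableEq (TiltedSite d i j Mu Mv L)] {Λ : Finset (ZdEdge d)}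
    (hinj : Set.InjOn (fun p : ZdPlaquette d =>
      ((((p.1 : TiltedSite d i j Mu Mv L)), p.2) : Plaq (TiltedSite d i j Mu Mv L) d))
      ↑(plaquettesTouching Λ))
    (V : Config (TiltedSite d i j Mu Mv L) d G) :
    ∑ q ∈ (plaquettesTouching Λ).image (fun p : ZdPlaquette d =>
        ((((p.1 : TiltedSite d i j Mu Mv L)), p.2) : Plaq (TiltedSite d i j Mu Mv L) d)),
      ((N : ℝ) - plaqObs ρ (tiltedUnit d i j Mu Mv L) q V) =
      wilsonBoundaryAction ρ Λ (tiltedLift d i j Mu Mv L V) := by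
  classical
  rw [sum_image hinj, wilsonBoundaryAction]
  refine sum_congr rfl fun p _ => ?_
  simp only [plaqObs, plaquetteObs, holonomy_mk]

/-- **Far part**: a plaquette term none of whose four links is `l` does not change when the link `l`
is updated. -/
theorem plaqObs_update_of_ne [DecidableEq (TiltedSite d i j Mu Mv L)]
    (V : Config (TiltedSite d i j Mu Mv L) d G) (l : Link (TiltedSite d i j Mu Mv L) d) (h : G)
    (q : Plaq (TiltedSite d i j Mu Mv L) d)
    (h1 : l ≠ (q.1, q.2.1.1)) (h2 : l ≠ (q.1 + tiltedUnit d i j Mu Mv L q.2.1.1, q.2.1.2))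
    (h3 : l ≠ (q.1 + tiltedUnit d i j Mu Mv L q.2.1.2, q.2.1.1)) (h4 : l ≠ (q.1, q.2.1.2)) :
    plaqObs ρ (tiltedUnit d i j Mu Mv L) q (Function.update V l h) =
      plaqObs ρ (tiltedUnit d i j Mu Mv L) q V := by
  simp only [plaqObs]
  rw [holonomy_congr (tiltedUnit d i j Mu Mv L) q.1 q.2.1.1 q.2.1.2
    (Function.update_of_ne (Ne.symm h1) _ _) (Function.update_of_ne (Ne.symm h2) _ _)
    (Function.update_of_ne (Ne.symm h3) _ _) (Function.update_of_ne (Ne.symm h4) _ _)]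

omit [Group G] in
/-- **Lifting an update**: on the edges of a finite set `T ∋ e` on which the quotient map is
injective, the lift of the box configuration updated below `e` is the lift updated at `e`. -/
theorem tiltedLift_update_apply [DecidableEq (TiltedSite d i j Mu Mv L)] {T : Finset (ZdEdge d)}
    (hinj : Set.InjOn (tiltedEdge d i j Mu Mv L) ↑T) {e : ZdEdge d} (he : e ∈ T)
    (V : Config (TiltedSite d i j Mu Mv L) d G) (h : G) {e' : ZdEdge d} (he' : e' ∈ T) :
    tiltedLift d i j Mu Mv L (Function.update V (tiltedEdge d i j Mu Mv L e) h) e' =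
      Function.update (tiltedLift d i j Mu Mv L V) e h e' := by
  by_cases hee : e' = e
  · subst hee
    simp only [tiltedLift, Function.update_self]
  · have hne : tiltedEdge d i j Mu Mv L e' ≠ tiltedEdge d i j Mu Mv L e :=
      fun H => hee (hinj he' he H)
    simp only [tiltedLift, Function.update_of_ne hee, Function.update_of_ne hne]

omit [Group G] in
/-- **A cylinder observable does not see the difference** between the two updates. -/
theorem apply_update_tiltedLift [DecidableEq (TiltedSite d i j Mu Mv L)] {α : Type*}
    {f : LGConfig d G → α} {S : Finset (ZdEdge d)} (hf : IsCylinder f S) (e : ZdEdge d)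
    (hinj : Set.InjOn (tiltedEdge d i j Mu Mv L) ↑(insert e S))
    (V : Config (TiltedSite d i j Mu Mv L) d G) (h : G) :
    f (Function.update (tiltedLift d i j Mu Mv L V) e h) =
      f (tiltedLift d i j Mu Mv L (Function.update V (tiltedEdge d i j Mu Mv L e) h)) :=
  hf fun _ he' => (tiltedLift_update_apply hinj (mem_insert_self e S) V h
    (mem_insert_of_mem (mem_coe.1 he'))).symm

/-- **The change of the full box action under a one-link update is the change of the boundary
action of the lift** (quotient map injective near `e`). -/
theorem wilsonAction_update_sub_eq [NeZero Mu] [NeZero Mv] [NeZero L]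
    [DecidableEq (TiltedSite d i j Mu Mv L)] (e : ZdEdge d)
    (hinj : Set.InjOn (fun x : Site d => (x : TiltedSite d i j Mu Mv L))
      ↑(((plaquettesTouching ({e} : Finset (ZdEdge d))).biUnion plaquetteEdges).image Prod.fst))
    (V : Config (TiltedSite d i j Mu Mv L) d G) (h : G) :
    wilsonAction ρ (tiltedUnit d i j Mu Mv L) (Function.update V (tiltedEdge d i j Mu Mv L e) h) -
        wilsonAction ρ (tiltedUnit d i j Mu Mv L) V =
      wilsonBoundaryAction ρ {e} (Function.update (tiltedLift d i j Mu Mv L V) e h) -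
        wilsonBoundaryAction ρ {e} (tiltedLift d i j Mu Mv L V) := by
  classical
  set T₀ : Finset (ZdEdge d) := (plaquettesTouching ({e} : Finset (ZdEdge d))).biUnion plaquetteEdges
  set mkP : ZdPlaquette d → Plaq (TiltedSite d i j Mu Mv L) d := fun p =>
    (((p.1 : TiltedSite d i j Mu Mv L)), p.2)
  have hinjP : Set.InjOn mkP ↑(plaquettesTouching ({e} : Finset (ZdEdge d))) := injOn_mkPlaquette hinj
  have hinjE : Set.InjOn (tiltedEdge d i j Mu Mv L) ↑T₀ := injOn_tiltedEdge hinj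
  have heT₀ : ∀ e' ∈ T₀, e ∈ T₀ := by
    intro e' he'
    obtain ⟨p, hp, -⟩ := mem_biUnion.1 he'
    obtain ⟨e'', he''⟩ := mem_plaquettesTouching_iff.1 hp
    rw [mem_inter, mem_singleton] at he''
    exact mem_biUnion.2 ⟨p, hp, he''.2 ▸ he''.1⟩
  have hW : wilsonBoundaryAction ρ {e} (Function.update (tiltedLift d i j Mu Mv L V) e h) =
      wilsonBoundaryAction ρ {e} (tiltedLift d i j Mu Mv L
        (Function.update V (tiltedEdge d i j Mu Mv L e) h)) :=
    isCylinder_wilsonBoundaryAction_holds ρ {e} fun e' he' =>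
      (tiltedLift_update_apply hinjE (heT₀ e' (mem_coe.1 he')) V h (mem_coe.1 he')).symm
  rw [hW, ← sum_image_mk_plaquetteTerm ρ hinjP, ← sum_image_mk_plaquetteTerm ρ hinjP,
    ← sum_sub_distrib, wilsonAction, wilsonAction, ← sum_sub_distrib]
  symm
  refine sum_subset (subset_univ _) fun q _ hq => ?_
  have hne : ∀ p ∈ plaquettesTouching ({e} : Finset (ZdEdge d)), mkP p ≠ q := by
    intro p hp hpq
    exact hq (mem_image.2 ⟨p, hp, hpq⟩)
  have hl : tiltedEdge d i j Mu Mv L e ≠ (q.1, q.2.1.1) ∧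
      tiltedEdge d i j Mu Mv L e ≠ (q.1 + tiltedUnit d i j Mu Mv L q.2.1.1, q.2.1.2) ∧
      tiltedEdge d i j Mu Mv L e ≠ (q.1 + tiltedUnit d i j Mu Mv L q.2.1.2, q.2.1.1) ∧
      tiltedEdge d i j Mu Mv L e ≠ (q.1, q.2.1.2) := by
    refine ⟨fun H => ?_, fun H => ?_, fun H => ?_, fun H => ?_⟩
    · obtain ⟨p, hp, hpq⟩ := exists_mk_eq_of_tiltedEdge_eq e q (Or.inl H)
      exact hne p hp hpq
    · obtain ⟨p, hp, hpq⟩ := exists_mk_eq_of_tiltedEdge_eq e q (Or.inr (Or.inl H))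
      exact hne p hp hpq
    · obtain ⟨p, hp, hpq⟩ := exists_mk_eq_of_tiltedEdge_eq e q (Or.inr (Or.inr (Or.inl H)))
      exact hne p hp hpq
    · obtain ⟨p, hp, hpq⟩ := exists_mk_eq_of_tiltedEdge_eq e q (Or.inr (Or.inr (Or.inr H)))
      exact hne p hp hpq
  rw [plaqObs_update_of_ne ρ V _ h q hl.1 hl.2.1 hl.2.2.1 hl.2.2.2, sub_self]

end Plaquettes

/-! ## The Haar-shift identity of the limit points -/

section Limit

variable {d : ℕ} {i j : Fin d} {N : ℕ}
variable {G : Type*} [Group G] [TopologicalSpace G] [IsTopologicalGroup G] [CompactSpace G]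
  [MeasurableSpace G] [BorelSpace G]
variable (ρ : G →* Matrix (Fin N) (Fin N) ℂ)

/-- **Box step**: for a box whose quotient map is injective on the base points of
`insert e (S ∪ T₀)` (`T₀` the edges of the plaquettes containing `e`), the lifted expectations of
`f(U[e ↦ g U_e])` and of `f(U) exp(-β (S_e(U[e ↦ g⁻¹ U_e]) - S_e(U)))` coincide (`f` a cylinder
observable with support `S`). -/
theorem integral_haarShift_tiltedLift {Mu Mv L : ℕ} [NeZero Mu] [NeZero Mv] [NeZero L]
    (β : ℝ) (e : ZdEdge d) (g : G) {f : LGConfig d G → ℝ}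
    {S : Finset (ZdEdge d)} (hfS : IsCylinder f S)
    (hinj : Set.InjOn (fun x : Site d => (x : TiltedSite d i j Mu Mv L))
      ↑((insert e (S ∪ (plaquettesTouching ({e} : Finset (ZdEdge d))).biUnion plaquetteEdges)).image
        Prod.fst)) :
    ∫ V, f (Function.update (tiltedLift d i j Mu Mv L V) e (g * tiltedLift d i j Mu Mv L V e))
        ∂(gibbs ρ (tiltedUnit d i j Mu Mv L) β) =
      ∫ V, f (tiltedLift d i j Mu Mv L V) * Real.exp (-(β *
        (wilsonBoundaryAction ρ {e} (Function.update (tiltedLift d i j Mu Mv L V) e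
            (g⁻¹ * tiltedLift d i j Mu Mv L V e)) -
          wilsonBoundaryAction ρ {e} (tiltedLift d i j Mu Mv L V))))
        ∂(gibbs ρ (tiltedUnit d i j Mu Mv L) β) := by
  classical
  set T₀ : Finset (ZdEdge d) := (plaquettesTouching ({e} : Finset (ZdEdge d))).biUnion plaquetteEdges
  have hinjS : Set.InjOn (tiltedEdge d i j Mu Mv L) ↑(insert e S) := by
    refine injOn_tiltedEdge (hinj.mono ?_)
    rw [coe_subset]
    exact image_subset_image (insert_subset_insert e subset_union_left)
  have hinj₀ : Set.InjOn (fun x : Site d => (x : TiltedSite d i j Mu Mv L)) ↑(T₀.image Prod.fst) := by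
    refine hinj.mono ?_
    rw [coe_subset]
    exact image_subset_image ((subset_union_right).trans (subset_insert e _))
  have h1 : ∀ V : Config (TiltedSite d i j Mu Mv L) d G,
      f (Function.update (tiltedLift d i j Mu Mv L V) e (g * tiltedLift d i j Mu Mv L V e)) =
        (fun W => f (tiltedLift d i j Mu Mv L W))
          (Function.update V (tiltedEdge d i j Mu Mv L e) (g * V (tiltedEdge d i j Mu Mv L e))) :=
    fun V => apply_update_tiltedLift hfS e hinjS V _
  simp_rw [h1]
  rw [integral_comp_update_mul_gibbs ρ (tiltedUnit d i j Mu Mv L) β (tiltedEdge d i j Mu Mv L e) g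
    (fun W => f (tiltedLift d i j Mu Mv L W))]
  refine integral_congr_ae (ae_of_all _ fun V => ?_)
  simp only
  rw [wilsonAction_update_sub_eq ρ e hinj₀ V]
  rfl

/-- **Every tilted limit point is a one-link Gibbs (Haar-shift) state of the Wilson action**
(`ClassB.IsHaarShiftState`), at every real `β`. -/
theorem isHaarShiftState_of_mem_tiltedBoxLimitPoints (hρ : Continuous ρ) {β : ℝ}
    {μ : Measure (LGConfig d G)} (hμ : μ ∈ tiltedBoxLimitPoints d i j ρ β) :
    IsHaarShiftState ρ β μ := by
  classical
  intro e g f S hfS hfc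
  obtain ⟨M, Q, hM, hQ, h⟩ := hμ
  haveI := h.1
  set T₀ : Finset (ZdEdge d) := (plaquettesTouching ({e} : Finset (ZdEdge d))).biUnion plaquetteEdges
  set F₁ : LGConfig d G → ℝ := fun U => f (Function.update U e (g * U e)) with hF₁
  set F₂ : LGConfig d G → ℝ := fun U => f U * Real.exp (-(β *
    (wilsonBoundaryAction ρ {e} (Function.update U e (g⁻¹ * U e)) -
      wilsonBoundaryAction ρ {e} U))) with hF₂
  have hF₁c : Continuous F₁ := hfc.comp (continuous_update_mul e g)
  have hWc : Continuous (wilsonBoundaryAction (G := G) ρ ({e} : Finset (ZdEdge d))) :=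
    continuous_wilsonBoundaryAction ρ hρ {e}
  have hF₂c : Continuous F₂ :=
    hfc.mul (((hWc.comp (continuous_update_mul e g⁻¹)).sub hWc).const_mul β).neg.rexp
  have hWcyl := isCylinder_wilsonBoundaryAction_holds (d := d) (G := G) ρ {e}
  have hF₁S : IsCylinder F₁ (insert e S) := by
    intro U V hUV
    simp only [hF₁]
    refine hfS fun e' he' => ?_
    by_cases hee : e' = e
    · subst hee
      rw [Function.update_self, Function.update_self, hUV _ (mem_coe.2 (mem_insert_self _ S))]
    · rw [Function.update_of_ne hee, Function.update_of_ne hee,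
        hUV _ (mem_coe.2 (mem_insert_of_mem (mem_coe.1 he')))]
  have hF₂S : IsCylinder F₂ (insert e (S ∪ T₀)) := by
    intro U V hUV
    have hf' : f U = f V := hfS fun e' he' =>
      hUV _ (mem_coe.2 (mem_insert_of_mem (mem_union_left _ (mem_coe.1 he'))))
    have hW0 : wilsonBoundaryAction ρ {e} U = wilsonBoundaryAction ρ {e} V := hWcyl fun e' he' =>
      hUV _ (mem_coe.2 (mem_insert_of_mem (mem_union_right _ (mem_coe.1 he'))))
    have hUe : U e = V e := hUV _ (mem_coe.2 (mem_insert_self _ _))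
    have hW1 : wilsonBoundaryAction ρ {e} (Function.update U e (g⁻¹ * U e)) =
        wilsonBoundaryAction ρ {e} (Function.update V e (g⁻¹ * V e)) := hWcyl fun e' he' => by
      by_cases hee : e' = e
      · subst hee; rw [Function.update_self, Function.update_self, hUe]
      · rw [Function.update_of_ne hee, Function.update_of_ne hee,
          hUV _ (mem_coe.2 (mem_insert_of_mem (mem_union_right _ (mem_coe.1 he'))))]
    simp only [hF₂, hf', hW0, hW1]
  obtain ⟨C₁, hC₁⟩ := exists_bound_of_continuous hF₁c
  obtain ⟨C₂, hC₂⟩ := exists_bound_of_continuous hF₂c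
  have h1 := h.tendsto_integral hF₁S hF₁c hC₁
  have h2 := h.tendsto_integral hF₂S hF₂c hC₂
  -- the box expectations agree eventually
  have hev : ∀ᶠ k in atTop,
      ∫ V, F₁ (tiltedLift d i j (M k + 2) (M k + 2) (2 * (Q k + 2)) V)
          ∂(gibbs ρ (tiltedUnit d i j (M k + 2) (M k + 2) (2 * (Q k + 2))) β) =
        ∫ V, F₂ (tiltedLift d i j (M k + 2) (M k + 2) (2 * (Q k + 2)) V)
          ∂(gibbs ρ (tiltedUnit d i j (M k + 2) (M k + 2) (2 * (Q k + 2))) β) := by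
    filter_upwards [eventually_injOn_mk (i := i) (j := j) hM hQ ((insert e (S ∪ T₀)).image Prod.fst)]
      with k hk
    exact integral_haarShift_tiltedLift ρ β e g hfS hk
  exact tendsto_nhds_unique (h1.congr' hev) h2

end Limit

end TiltedRP

end Summit.QuantumFields.GaugeBoot
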